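import Literature.Analysis.Complex.VerticalLineShift
import Literature.Analysis.FunctionSpaces.PlancherelL1L2
import Mathlib.Analysis.MellinInversion
import Mathlib.Analysis.SpecialFunctions.Pow.Deriv
import Mathlib.Analysis.Complex.CauchyIntegral
import Mathlib.Analysis.Analytic.Uniqueness
import HarnessLib

/-!
# Mellin inversion on vertical lines, the other way round; holomorphic continuation of `𝓜 S`
# from a one-sided bound on `S = 𝓜⁻¹ φ`; Booker's `Ω`-lemma

Topic `Literature/Analysis/Complex` (vertical-line contour integration; continues
`VerticalLineShift.lean`). Everything here is PROVED; there are no named facts.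

Mathlib proves `𝓜⁻¹_σ (𝓜 f) = f` (`mellinInv_mellin_eq`). This file treats the inverse transform
`S = 𝓜⁻¹_σ φ`, `S(x) = (1/2π) ∫ φ(σ+iy) x^{-(σ+iy)} dy = (1/2πi) ∫_{(σ)} φ(s) x^{-s} ds` (Mathlib's
`mellinInv σ φ`) of a function `φ` given on vertical lines:
* `norm_mellinInv_le`, `continuousOn_mellinInv` — `‖S(x)‖ ≤ (1/2π) x^{-σ} ‖φ(σ+i·)‖₁`; continuity
  of `S` on `(0, ∞)` when `φ(σ + i·)` is integrable (dominated convergence);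
* `mellinInv_eq_mellinInv_of_differentiableOn` — the line may be moved across a closed strip on
  which `φ` is holomorphic, integrable on both boundary lines and uniformly small on far-away
  horizontal segments (`integral_vertical_eq_of_differentiableOn` applied to `x^{-s} φ(s)`);
* `mellin_mellinInv_eq` — **Mellin inversion, second form**: `φ(σ+i·)` integrable and continuous
  at `t`, `S` Mellin-summable at `σ` ⟹ `𝓜 S (σ + it) = φ(σ + it)` (Fourier inversion
  `𝓕 𝓕⁻ = id`, Mathlib's `MeasureTheory.Integrable.fourier_fourierInv_eq`, along `x = e^{-u}`);
* `HalfPlaneDecay φ σ` (Booker's "holomorphic and of rapid decay in vertical strips in a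
  right-half plane") and its consequences `mellinInv_eq` (independence of the line),
  `isBigO_mellinInv_atTop` (`S = O(x^{-σ'})` at `+∞`), `differentiableOn_mellin_mellinInv` and
  `mellin_mellinInv_eqOn`: **if `S(x) = O(x^{-θ})` as `x → 0⁺`, `θ < σ`, then `𝓜 S` is
  holomorphic on `re s > θ` and equals `φ` on `re s ≥ σ`** (Booker's (16));
* `HalfPlaneDecay.not_isBigO_mellinInv` — **Booker's `Ω`-lemma** (Ann. of Math. 158 (2003),
  Lemma 4, p. 1095): "Let `φ(s)` be meromorphic in the complex plane, and holomorphic and of rapid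
  decay in vertical strips in a right-half plane. If `φ(s)` has a pole at `s = β + iτ`, then
  `(1/2πi) ∫ φ(s) x^{-s} ds = Ω_ε(x^{-(β-ε)})` as `x → 0` for all `ε > 0`", rendered: `φ`
  holomorphic on an open preconnected `U ⊆ {re s > θ}` meeting `{re s > σ}`, `‖φ‖ → ∞` at a
  point `p ∈ closure U` with `re p > θ` ⟹ `S ≠ O(x^{-θ})` at `0⁺` (`θ = β - ε`,
  `U = {re s > β - ε} ∖ {poles}`). Proof as printed ("(16) defines `φ(s)` holomorphically for
  `re s > β - ε`. This proves the contrapositive.") plus the identity theorem on `U`.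

Design notes. `φ` is `ℂ`-valued (as is the line-shifting lemma); the pole is rendered by
unboundedness from inside `U` (`Tendsto (‖φ ·‖) (𝓝[U] p) atTop`), implied by a genuine pole;
preconnectedness of `U` (automatic for a half-plane minus a discrete set) is left to the user.

## References

* A. R. Booker, *Poles of Artin L-functions and the strong Artin conjecture*, Ann. of Math. (2)
  158 (2003), 1089–1098: Lemma 4 and (16), p. 1095. [Booker2003]
* E. C. Titchmarsh, *Introduction to the theory of Fourier integrals* (1948), §1.29. [folklore]
-/

noncomputable section

open _root_.Complex Set MeasureTheory Filter Real Asymptotics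
open scoped _root_.Topology FourierTransform

namespace Literature.Analysis.Complex

/-! ### Pointwise bound and continuity of `𝓜⁻¹_σ φ` -/

/-- `‖x^{-(σ+iy)}‖ = x^{-σ}` for `x > 0`. [folklore] -/
theorem norm_cpow_neg_add_mul_I {x : ℝ} (hx : 0 < x) (σ y : ℝ) :
    ‖(x : ℂ) ^ (-((σ : ℂ) + y * I))‖ = x ^ (-σ) := by
  rw [Complex.norm_cpow_eq_rpow_re_of_pos hx]
  simp

/-- **Trivial bound for the inverse Mellin transform**: for `x > 0`,
`‖(𝓜⁻¹_σ φ)(x)‖ ≤ (1/2π) x^{-σ} ∫ ‖φ(σ+iy)‖ dy`. (If `φ(σ+i·)` is not integrable both sides are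
computed with Mathlib's junk value `0` for the divergent integrals and the bound still holds.)
[folklore] -/
theorem norm_mellinInv_le (σ : ℝ) (φ : ℂ → ℂ) {x : ℝ} (hx : 0 < x) :
    ‖mellinInv σ φ x‖ ≤ 1 / (2 * π) * x ^ (-σ) * ∫ y : ℝ, ‖φ (σ + y * I)‖ := by
  rw [mellinInv, norm_smul, Real.norm_of_nonneg (by positivity : (0 : ℝ) ≤ 1 / (2 * π)),
    mul_assoc]
  gcongr
  calc ‖∫ y : ℝ, (x : ℂ) ^ (-((σ : ℂ) + y * I)) • φ (σ + y * I)‖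
      ≤ ∫ y : ℝ, ‖(x : ℂ) ^ (-((σ : ℂ) + y * I)) • φ (σ + y * I)‖ :=
        norm_integral_le_integral_norm _
    _ = ∫ y : ℝ, x ^ (-σ) * ‖φ (σ + y * I)‖ := by
        congr 1 with y
        rw [norm_smul, norm_cpow_neg_add_mul_I hx]
    _ = x ^ (-σ) * ∫ y : ℝ, ‖φ (σ + y * I)‖ := integral_const_mul _ _

/-- For `x` in `[x₁, x₂] ⊆ (0, ∞)`, `x^{-c} ≤ max (x₁^{-c}) (x₂^{-c})`. [folklore] -/
theorem rpow_neg_le_max_of_mem_Icc {x₁ x₂ x : ℝ} (hx₁ : 0 < x₁) (hx : x ∈ Icc x₁ x₂) (c : ℝ) :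
    x ^ (-c) ≤ max (x₁ ^ (-c)) (x₂ ^ (-c)) := by
  have hx0 : 0 < x := hx₁.trans_le hx.1
  rcases le_or_gt 0 c with hc | hc
  · exact le_max_of_le_left
      (Real.rpow_le_rpow_of_nonpos hx₁ hx.1 (neg_nonpos.mpr hc))
  · exact le_max_of_le_right
      (Real.rpow_le_rpow hx0.le hx.2 (by linarith))

/-- For `c ∈ [a, b]` and `x > 0`, `x^{-c} ≤ max (x^{-a}) (x^{-b})`. [folklore] -/
theorem rpow_neg_le_max_of_exponent_mem_Icc {x : ℝ} (hx : 0 < x) {a b c : ℝ} (hc : c ∈ Icc a b) :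
    x ^ (-c) ≤ max (x ^ (-a)) (x ^ (-b)) := by
  rcases le_or_gt 1 x with h1 | h1
  · exact le_max_of_le_left (Real.rpow_le_rpow_of_exponent_le h1 (neg_le_neg hc.1))
  · exact le_max_of_le_right (Real.rpow_le_rpow_of_exponent_ge hx h1.le (neg_le_neg hc.2))

/-- **Continuity of the inverse Mellin transform**: if `φ(σ+i·)` is integrable then
`𝓜⁻¹_σ φ` is continuous on `(0, ∞)` (dominated convergence). [folklore] -/
theorem continuousOn_mellinInv {σ : ℝ} {φ : ℂ → ℂ} (hφ : VerticalIntegrable φ σ) :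
    ContinuousOn (mellinInv σ φ) (Ioi 0) := by
  intro x₀ hx₀
  have hx₀' : (0 : ℝ) < x₀ := hx₀
  apply ContinuousAt.continuousWithinAt
  change ContinuousAt (fun x : ℝ ↦ mellinInv σ φ x) x₀
  simp only [mellinInv]
  refine ContinuousAt.const_smul ?_ _
  have hx2 : 0 < x₀ / 2 := by positivity
  set M : ℝ := max ((x₀ / 2) ^ (-σ)) ((2 * x₀) ^ (-σ)) with hM
  have hmem : ∀ᶠ x in 𝓝 x₀, x ∈ Icc (x₀ / 2) (2 * x₀) :=
    Icc_mem_nhds (by linarith) (by linarith)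
  refine continuousAt_of_dominated (bound := fun y ↦ M * ‖φ (σ + y * I)‖) ?_ ?_ ?_ ?_
  · filter_upwards [hmem] with x hx
    have hx0 : 0 < x := hx2.trans_le hx.1
    have hc : Continuous fun y : ℝ ↦ (x : ℂ) ^ (-((σ : ℂ) + y * I)) :=
      continuous_iff_continuousAt.2 fun y ↦
        (continuousAt_const_cpow (ofReal_ne_zero.mpr hx0.ne')).comp (by fun_prop)
    exact hc.aestronglyMeasurable.smul hφ.aestronglyMeasurable
  · filter_upwards [hmem] with x hx
    have hx0 : 0 < x := hx2.trans_le hx.1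
    refine Eventually.of_forall fun y ↦ ?_
    rw [norm_smul, norm_cpow_neg_add_mul_I hx0]
    exact mul_le_mul_of_nonneg_right (rpow_neg_le_max_of_mem_Icc hx2 hx σ) (norm_nonneg _)
  · exact hφ.norm.const_mul M
  · refine Eventually.of_forall fun y ↦ ?_
    have h := Complex.continuousAt_ofReal_cpow_const x₀ (-((σ : ℂ) + y * I)) (Or.inr hx₀'.ne')
    exact h.smul (continuousAt_const (y := φ (σ + y * I)))

/-! ### Moving the line of integration -/

/-- **The inverse Mellin transform does not depend on the line** across a pole-free strip: if
`φ` is holomorphic on the closed strip `a ≤ re s ≤ b`, integrable on both boundary lines and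
uniformly small on the horizontal segments `[a, b] + iT` as `|T| → ∞`, then
`𝓜⁻¹_a φ (x) = 𝓜⁻¹_b φ (x)` for every `x > 0`. [folklore] -/
theorem mellinInv_eq_mellinInv_of_differentiableOn {φ : ℂ → ℂ} {a b : ℝ} (hab : a ≤ b)
    (hd : DifferentiableOn ℂ φ (re ⁻¹' Icc a b)) (ha : VerticalIntegrable φ a)
    (hb : VerticalIntegrable φ b)
    (hdecay : ∀ ε : ℝ, 0 < ε → ∃ T₀ : ℝ, ∀ T : ℝ, T₀ ≤ |T| →
      ∀ c ∈ Icc a b, ‖φ (c + T * I)‖ ≤ ε)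
    {x : ℝ} (hx : 0 < x) :
    mellinInv a φ x = mellinInv b φ x := by
  simp only [mellinInv, smul_eq_mul]
  congr 1
  set F : ℂ → ℂ := fun s ↦ (x : ℂ) ^ (-s) * φ s with hF
  have hx0 : (x : ℂ) ≠ 0 := ofReal_ne_zero.mpr hx.ne'
  -- integrability of `F` on a vertical line inside the strip
  have hint : ∀ c : ℝ, VerticalIntegrable φ c → Integrable fun y : ℝ ↦ F (c + y * I) := by
    intro c hc
    refine Integrable.mono' (hc.norm.const_mul (x ^ (-c))) ?_ (Eventually.of_forall fun y ↦ ?_)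
    · refine (Continuous.aestronglyMeasurable ?_).mul hc.aestronglyMeasurable
      refine continuous_iff_continuousAt.2 fun y ↦ ?_
      exact (continuousAt_const_cpow hx0).comp (by fun_prop)
    · simp only [hF]
      rw [norm_mul, norm_cpow_neg_add_mul_I hx]
  have key := integral_vertical_eq_of_differentiableOn (F := F) hab ?_ (hint a ha) (hint b hb) ?_
  · simpa only [hF] using key
  · intro s hs
    have h1 : DifferentiableAt ℂ (fun s : ℂ ↦ (x : ℂ) ^ (-s)) s :=
      differentiableAt_id.neg.const_cpow (Or.inl hx0)
    exact h1.differentiableWithinAt.mul (hd s hs)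
  · intro ε hε
    set M : ℝ := max (x ^ (-a)) (x ^ (-b)) with hM
    have hM0 : 0 < M := lt_max_of_lt_left (Real.rpow_pos_of_pos hx _)
    obtain ⟨T₀, hT₀⟩ := hdecay (ε / M) (div_pos hε hM0)
    refine ⟨T₀, fun T hT c hc ↦ ?_⟩
    simp only [hF]
    rw [norm_mul, show (-((c : ℂ) + T * I)) = -((c : ℂ) + T * I) from rfl,
      norm_cpow_neg_add_mul_I hx]
    calc x ^ (-c) * ‖φ (c + T * I)‖ ≤ M * (ε / M) :=
          mul_le_mul (rpow_neg_le_max_of_exponent_mem_Icc hx hc) (hT₀ T hT c hc)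
            (norm_nonneg _) hM0.le
      _ = ε := mul_div_cancel₀ ε hM0.ne'

/-! ### Mellin inversion, second form: `𝓜 (𝓜⁻¹_σ φ) = φ` on the line `re s = σ` -/

/-- `e^{-u} (e^{-u})^{σ-1} = e^{-σu}` in `ℂ`. [folklore] -/
theorem cexp_neg_mul_cexp_neg_cpow (u : ℝ) (σ : ℂ) :
    cexp (-u) * cexp (-u) ^ (σ - 1) = cexp (-(σ * u)) := by
  rw [cpow_def_of_ne_zero (Complex.exp_ne_zero _),
    Complex.log_exp (by simp [pi_pos]) (by simpa using pi_nonneg), ← Complex.exp_add]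
  ring_nf

/-- **Mellin-summability in the additive variable**: `S` is Mellin-summable at `σ` iff
`u ↦ e^{-σu} S(e^{-u})` is integrable on `ℝ` (the substitution `x = e^{-u}`, through the tree's
`Literature.Analysis.FunctionSpaces.integrableOn_Ioi_iff_integrable_exp_neg_smul`). [folklore] -/
theorem mellinConvergent_iff_integrable_exp_neg {S : ℝ → ℂ} {σ : ℝ} :
    MellinConvergent S σ ↔
      Integrable fun u : ℝ ↦ cexp (-((σ : ℂ) * u)) * S (Real.exp (-u)) := by
  rw [MellinConvergent,
    Literature.Analysis.FunctionSpaces.integrableOn_Ioi_iff_integrable_exp_neg_smul]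
  refine integrable_congr (Eventually.of_forall fun u ↦ ?_)
  simp only [smul_eq_mul, Complex.real_smul, Complex.ofReal_exp, Complex.ofReal_neg, ← mul_assoc]
  rw [cexp_neg_mul_cexp_neg_cpow]

/-- The inverse Fourier transform of `y ↦ φ(σ + 2πiy)` at `u` is `e^{-σu} · (𝓜⁻¹_σ φ)(e^{-u})`
(Mathlib's `mellinInv_eq_fourierInv` read at `x = e^{-u}`). [folklore] -/
theorem fourierInv_vertical_eq_mellinInv (σ : ℝ) (φ : ℂ → ℂ) (u : ℝ) :
    𝓕⁻ (fun y : ℝ ↦ φ (σ + 2 * π * y * I)) u =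
      cexp (-((σ : ℂ) * u)) * mellinInv σ φ (Real.exp (-u)) := by
  rw [mellinInv_eq_fourierInv σ φ (Real.exp_pos (-u)), Real.log_exp, neg_neg, smul_eq_mul,
    ← mul_assoc]
  have h : cexp (-((σ : ℂ) * u)) * ((Real.exp (-u) : ℝ) : ℂ) ^ (-(σ : ℂ)) = 1 := by
    rw [Complex.ofReal_exp, cpow_def_of_ne_zero (Complex.exp_ne_zero _),
      Complex.log_exp (by simp [pi_pos]) (by simpa using pi_nonneg), ← Complex.exp_add]
    push_cast
    ring_nf
    exact Complex.exp_zero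
  rw [h, one_mul]

/-- **Mellin inversion on a vertical line, second form.** If `φ(σ + i·)` is integrable on `ℝ`
and continuous at `t`, and `S = 𝓜⁻¹_σ φ` is Mellin-summable at `σ` (`∫₀^∞ ‖S(x)‖ x^{σ-1} dx < ∞`),
then `𝓜 S (σ + it) = φ(σ + it)` — the direction complementary to Mathlib's `mellinInv_mellin_eq`;
it is `𝓕 (𝓕⁻ G) = G` for `G(y) = φ(σ + 2πiy)` transported along `x = e^{-u}` (Titchmarsh,
*Fourier integrals*, §1.29; Booker 2003, (16)). [folklore] -/
theorem mellin_mellinInv_eq (σ : ℝ) (φ : ℂ → ℂ) {t : ℝ} (hφ : VerticalIntegrable φ σ)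
    (hS : MellinConvergent (mellinInv σ φ) σ)
    (hφt : ContinuousAt (fun y : ℝ ↦ φ (σ + y * I)) t) :
    mellin (mellinInv σ φ) (σ + t * I) = φ (σ + t * I) := by
  set G : ℝ → ℂ := fun y ↦ φ (σ + 2 * π * y * I) with hG
  have h2π : (2 * π : ℝ) ≠ 0 := by positivity
  have hGeq : G = (fun y : ℝ ↦ φ (σ + y * I)) ∘ fun y : ℝ ↦ 2 * π * y := by
    ext y
    simp only [hG, Function.comp_apply]
    push_cast
    ring_nf
  -- `G` is integrable and continuous at `t / 2π`
  have hGi : Integrable G := by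
    rw [hGeq]
    exact hφ.comp_mul_left' h2π
  have hGc : ContinuousAt G (t / (2 * π)) := by
    rw [hGeq]
    refine ContinuousAt.comp ?_ (by fun_prop)
    simpa only [mul_div_cancel₀ _ h2π] using hφt
  -- `𝓕 G` is integrable: `𝓕 G (w) = 𝓕⁻ G (-w)` and `𝓕⁻ G (u) = e^{-σu} S(e^{-u})`
  have hFGi : Integrable (𝓕 G) := by
    have h1 : Integrable (𝓕⁻ G) := by
      rw [mellinConvergent_iff_integrable_exp_neg] at hS
      exact hS.congr (Eventually.of_forall fun u ↦ (fourierInv_vertical_eq_mellinInv σ φ u).symm)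
    have h2 : 𝓕 G = fun w ↦ 𝓕⁻ G (-w) := by
      ext w
      rw [fourierInv_eq_fourier_neg, neg_neg]
    rw [h2]
    exact h1.comp_neg
  rw [mellin_eq_fourier, show ((σ : ℂ) + t * I).re = σ by simp, show ((σ : ℂ) + t * I).im = t by simp]
  have hint : (fun u : ℝ ↦ Real.exp (-σ * u) • mellinInv σ φ (Real.exp (-u))) = 𝓕⁻ G := by
    ext u
    rw [fourierInv_vertical_eq_mellinInv σ φ u, Complex.real_smul]
    push_cast
    ring_nf
  rw [hint, hGi.fourier_fourierInv_eq hFGi hGc]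
  simp only [hG]
  congr 1
  push_cast
  field_simp

/-! ### Holomorphy and decay in a closed right half-plane; continuation of `𝓜 S` -/

/-- **Standing hypothesis of Booker's `Ω`-lemma** ("`φ` holomorphic and of rapid decay in
vertical strips in a right half-plane", Booker 2003, Lemma 4), in the form the proofs consume:
`φ` is complex differentiable on the closed half-plane `re s ≥ σ`, `y ↦ φ(σ' + iy)` is integrable
for every `σ' ≥ σ`, and on every closed strip `σ ≤ re s ≤ σ'` the function is uniformly small on
the horizontal segments `[σ, σ'] + iT` as `|T| → ∞`. [cite: Booker2003, Lemma 4 (p. 1095)] -/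
structure HalfPlaneDecay (φ : ℂ → ℂ) (σ : ℝ) : Prop where
  /-- `φ` is holomorphic on (a neighbourhood within) the closed half-plane `re s ≥ σ`. -/
  differentiableOn : DifferentiableOn ℂ φ {s : ℂ | σ ≤ s.re}
  /-- `φ` is absolutely integrable on every vertical line `re s = σ' ≥ σ`. -/
  verticalIntegrable : ∀ ⦃σ' : ℝ⦄, σ ≤ σ' → VerticalIntegrable φ σ'
  /-- `φ → 0` uniformly on the horizontal segments `[σ, σ'] + iT`, `|T| → ∞`. -/
  horizontal_decay : ∀ ⦃σ' : ℝ⦄, σ ≤ σ' → ∀ ε : ℝ, 0 < ε → ∃ T₀ : ℝ, ∀ T : ℝ, T₀ ≤ |T| →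
    ∀ c ∈ Icc σ σ', ‖φ (c + T * I)‖ ≤ ε

namespace HalfPlaneDecay

variable {φ : ℂ → ℂ} {σ : ℝ}

/-- **Independence of the line** ("shifting the contour to the right"): under `HalfPlaneDecay φ σ`,
`𝓜⁻¹_σ φ (x) = 𝓜⁻¹_{σ'} φ (x)` for every `σ' ≥ σ` and `x > 0`.
[cite: Booker2003, Lemma 4 (p. 1095, proof)] -/
theorem mellinInv_eq (h : HalfPlaneDecay φ σ) {σ' : ℝ} (hσ' : σ ≤ σ') {x : ℝ} (hx : 0 < x) :
    mellinInv σ φ x = mellinInv σ' φ x :=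
  mellinInv_eq_mellinInv_of_differentiableOn hσ' (h.differentiableOn.mono fun _ hs ↦ hs.1)
    (h.verticalIntegrable le_rfl) (h.verticalIntegrable hσ') (h.horizontal_decay hσ') hx

/-- `‖𝓜⁻¹_σ φ (x)‖ ≤ (1/2π) x^{-σ'} ‖φ(σ' + i·)‖₁` on every line `σ' ≥ σ`. [folklore] -/
theorem norm_mellinInv_le (h : HalfPlaneDecay φ σ) {σ' : ℝ} (hσ' : σ ≤ σ') {x : ℝ} (hx : 0 < x) :
    ‖mellinInv σ φ x‖ ≤ 1 / (2 * π) * x ^ (-σ') * ∫ y : ℝ, ‖φ (σ' + y * I)‖ := by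
  rw [h.mellinInv_eq hσ' hx]
  exact Literature.Analysis.Complex.norm_mellinInv_le σ' φ hx

/-- **"`S(x)` is of rapid decay as `x → ∞`"**: `𝓜⁻¹_σ φ = O(x^{-σ'})` at `+∞` for every
`σ' ≥ σ`. [cite: Booker2003, Lemma 4 (p. 1095, proof)] -/
theorem isBigO_mellinInv_atTop (h : HalfPlaneDecay φ σ) {σ' : ℝ} (hσ' : σ ≤ σ') :
    mellinInv σ φ =O[atTop] fun x : ℝ ↦ x ^ (-σ') := by
  refine IsBigO.of_bound (1 / (2 * π) * ∫ y : ℝ, ‖φ (σ' + y * I)‖) ?_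
  filter_upwards [eventually_gt_atTop 0] with x hx
  rw [Real.norm_of_nonneg (Real.rpow_nonneg hx.le _)]
  calc ‖mellinInv σ φ x‖ ≤ 1 / (2 * π) * x ^ (-σ') * ∫ y : ℝ, ‖φ (σ' + y * I)‖ :=
        h.norm_mellinInv_le hσ' hx
    _ = (1 / (2 * π) * ∫ y : ℝ, ‖φ (σ' + y * I)‖) * x ^ (-σ') := by ring

/-- `𝓜⁻¹_σ φ` is continuous on `(0, ∞)`. [folklore] -/
theorem continuousOn_mellinInv (h : HalfPlaneDecay φ σ) : ContinuousOn (mellinInv σ φ) (Ioi 0) :=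
  Literature.Analysis.Complex.continuousOn_mellinInv (h.verticalIntegrable le_rfl)

/-- `𝓜⁻¹_σ φ` is locally integrable on `(0, ∞)`. [folklore] -/
theorem locallyIntegrableOn_mellinInv (h : HalfPlaneDecay φ σ) :
    LocallyIntegrableOn (mellinInv σ φ) (Ioi 0) :=
  h.continuousOn_mellinInv.locallyIntegrableOn measurableSet_Ioi

/-- If moreover `𝓜⁻¹_σ φ = O(x^{-θ})` as `x → 0⁺`, then `S = 𝓜⁻¹_σ φ` is Mellin-summable at
every `s` with `re s > θ`. [cite: Booker2003, Lemma 4 (p. 1095, proof)] -/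
theorem mellinConvergent_mellinInv (h : HalfPlaneDecay φ σ) {θ : ℝ}
    (hO : mellinInv σ φ =O[𝓝[>] 0] fun x : ℝ ↦ x ^ (-θ)) {s : ℂ} (hs : θ < s.re) :
    MellinConvergent (mellinInv σ φ) s :=
  mellinConvergent_of_isBigO_rpow h.locallyIntegrableOn_mellinInv
    (h.isBigO_mellinInv_atTop (le_max_left σ (s.re + 1)))
    (by have := le_max_right σ (s.re + 1); linarith) hO hs

/-- **Holomorphic continuation, part 1** ("(16) defines `φ(s)` holomorphically for
`re s > β - ε`"): if `𝓜⁻¹_σ φ = O(x^{-θ})` as `x → 0⁺`, then `𝓜 (𝓜⁻¹_σ φ)` is holomorphic on the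
half-plane `re s > θ`. [cite: Booker2003, Lemma 4 (p. 1095)] -/
theorem differentiableOn_mellin_mellinInv (h : HalfPlaneDecay φ σ) {θ : ℝ}
    (hO : mellinInv σ φ =O[𝓝[>] 0] fun x : ℝ ↦ x ^ (-θ)) :
    DifferentiableOn ℂ (mellin (mellinInv σ φ)) {s : ℂ | θ < s.re} := fun s hs ↦
  (mellin_differentiableAt_of_isBigO_rpow h.locallyIntegrableOn_mellinInv
    (h.isBigO_mellinInv_atTop (le_max_left σ (s.re + 1)))
    (by have := le_max_right σ (s.re + 1); linarith) hO hs).differentiableWithinAt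

/-- **Holomorphic continuation, part 2** (Booker's (16), `φ(s) = ∫₀^∞ S(x) x^{s-1} dx`): if
`𝓜⁻¹_σ φ = O(x^{-θ})` as `x → 0⁺` with `θ < σ`, then `𝓜 (𝓜⁻¹_σ φ) = φ` on the closed half-plane
`re s ≥ σ`. With part 1: `φ` continues analytically from `re s ≥ σ` to `re s > θ`.
[cite: Booker2003, Lemma 4 (p. 1095)] -/
theorem mellin_mellinInv_eqOn (h : HalfPlaneDecay φ σ) {θ : ℝ} (hθ : θ < σ)
    (hO : mellinInv σ φ =O[𝓝[>] 0] fun x : ℝ ↦ x ^ (-θ)) :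
    EqOn (mellin (mellinInv σ φ)) φ {s : ℂ | σ ≤ s.re} := by
  intro s hs
  obtain ⟨σ', t, rfl⟩ : ∃ σ' t : ℝ, s = (σ' : ℂ) + t * I := ⟨s.re, s.im, (re_add_im s).symm⟩
  have hσ' : σ ≤ σ' := by simpa using hs
  have hSS' : EqOn (mellinInv σ φ) (mellinInv σ' φ) (Ioi 0) := fun x hx ↦ h.mellinInv_eq hσ' hx
  have hmel : mellin (mellinInv σ φ) (σ' + t * I) = mellin (mellinInv σ' φ) (σ' + t * I) := by
    simp only [mellin]
    exact setIntegral_congr_fun measurableSet_Ioi fun x hx ↦ by rw [hSS' hx]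
  have hconv : MellinConvergent (mellinInv σ' φ) σ' := by
    have h1 : MellinConvergent (mellinInv σ φ) (σ' : ℂ) :=
      h.mellinConvergent_mellinInv hO (by simpa using hθ.trans_le hσ')
    exact IntegrableOn.congr_fun h1 (fun x hx ↦ by simp only [hSS' hx]) measurableSet_Ioi
  have hcont : ContinuousAt (fun y : ℝ ↦ φ (σ' + y * I)) t := by
    have hline : Continuous fun y : ℝ ↦ (σ' : ℂ) + y * I := by fun_prop
    exact (h.differentiableOn.continuousOn.comp_continuous hline fun y ↦ by simpa using hσ').continuousAt
  rw [hmel]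
  exact mellin_mellinInv_eq σ' φ (h.verticalIntegrable hσ') hconv hcont

/-- **Booker's `Ω`-lemma** (Booker 2003, Lemma 4, quoted in the module docstring), with `θ`
for `β - ε` and `S = 𝓜⁻¹_σ φ = (1/2πi) ∫_{(σ)} φ(s) x^{-s} ds`: let `φ` satisfy
`HalfPlaneDecay φ σ` and be holomorphic on an open preconnected `U ⊆ {re s > θ}` meeting the open
half-plane `re s > σ`; if `‖φ‖ → ∞` at a point `p ∈ closure U` with `re p > θ` (e.g. a pole at
`p = β + iτ`, `U = {re s > β - ε} ∖ {poles of φ}`), then `S(x)` is **not** `O(x^{-θ})` as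
`x → 0⁺`. Proof as printed: otherwise `𝓜 S` is holomorphic on `re s > θ` and equals `φ` on
`re s ≥ σ`, hence on `U` (identity theorem), so `φ` would be bounded near `p`.
[cite: Booker2003, Lemma 4 (p. 1095)] -/
theorem not_isBigO_mellinInv (h : HalfPlaneDecay φ σ) {θ : ℝ} (hθ : θ < σ) {U : Set ℂ}
    (hUo : IsOpen U) (hUc : IsPreconnected U) (hUθ : U ⊆ {s : ℂ | θ < s.re})
    (hφU : DifferentiableOn ℂ φ U) (hne : (U ∩ {s : ℂ | σ < s.re}).Nonempty) {p : ℂ}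
    (hp : θ < p.re) (hpU : p ∈ closure U)
    (hblow : Tendsto (fun s ↦ ‖φ s‖) (𝓝[U] p) atTop) :
    ¬ (mellinInv σ φ =O[𝓝[>] 0] fun x : ℝ ↦ x ^ (-θ)) := by
  intro hO
  haveI : (𝓝[U] p).NeBot := mem_closure_iff_nhdsWithin_neBot.mp hpU
  set ψ : ℂ → ℂ := mellin (mellinInv σ φ) with hψ
  have hψd : DifferentiableOn ℂ ψ {s : ℂ | θ < s.re} := h.differentiableOn_mellin_mellinInv hO
  have hopen : IsOpen {s : ℂ | θ < s.re} := isOpen_lt continuous_const Complex.continuous_re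
  -- `φ = ψ` on `U`, by the identity theorem from the agreement on `re s ≥ σ`
  obtain ⟨z₀, hz₀U, hz₀σ⟩ := hne
  have hEq : EqOn φ ψ U := by
    have hφa : AnalyticOnNhd ℂ φ U := (Complex.analyticOnNhd_iff_differentiableOn hUo).2 hφU
    have hψa : AnalyticOnNhd ℂ ψ U :=
      (Complex.analyticOnNhd_iff_differentiableOn hUo).2 (hψd.mono hUθ)
    refine hφa.eqOn_of_preconnected_of_eventuallyEq hψa hUc hz₀U ?_
    have hmem : {s : ℂ | σ < s.re} ∈ 𝓝 z₀ :=
      (isOpen_lt continuous_const Complex.continuous_re).mem_nhds hz₀σ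
    filter_upwards [hmem] with s hs
    exact (h.mellin_mellinInv_eqOn hθ hO (le_of_lt hs)).symm
  -- `ψ` is bounded near `p`, `φ` is not
  have hψc : ContinuousAt ψ p :=
    ((hψd p hp).differentiableAt (hopen.mem_nhds hp)).continuousAt
  have hbd : ∀ᶠ s in 𝓝 p, ‖ψ s‖ < ‖ψ p‖ + 1 :=
    hψc.norm.eventually_lt continuousAt_const (lt_add_one _)
  have h1 : ∀ᶠ s in 𝓝[U] p, ‖ψ s‖ < ‖ψ p‖ + 1 := hbd.filter_mono nhdsWithin_le_nhds
  have h2 : ∀ᶠ s in 𝓝[U] p, s ∈ U := self_mem_nhdsWithin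
  have h3 : ∀ᶠ s in 𝓝[U] p, ‖ψ p‖ + 1 ≤ ‖φ s‖ := hblow.eventually (eventually_ge_atTop _)
  obtain ⟨s, hs1, hs2, hs3⟩ := (h1.and (h2.and h3)).exists
  rw [hEq hs2] at hs3
  linarith

end HalfPlaneDecay

end Literature.Analysis.Complex
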